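import Summits.ValiantsHypothesis.ValiantsHypothesis.Theorems.BarrierLeverAnchoredDoorHitsLowerPairsStubGenericPoint
import Summits.ValiantsHypothesis.ValiantsHypothesis.Theorems.BarrierLeverPartitionMinorsHitByVPBrickCalculus

/-!
# Support item `AnchoredDoorHitsLowerPairs` (stmt-ValiantsHypothesis-22510), line `anchored-peeling`:
# the rigid family (∂Δⁿ, Δⁿ⁻¹ ⊔ Δⁿ⁻¹), part 1 — the explicit one-twist member of 𝔄₁ and its coefficient calculus

Helper file (`--supports stmt-ValiantsHypothesis-22510`; cell valiant-natproofs, rung V4, 𝒟-side door (c); prover seat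
val-np-p1 gen 16). Closes NO item. Part 2 (`…SimplexBoundary.lean`) proves that the symbolic minor of 𝔄₁ (hence of every
𝔄_s) is nonzero on the pair `P_n` = (boundary of the `n`-simplex on `x_0 … x_{n-1}, x_{2n}` ; two disjoint solid
`(n-1)`-simplices on `y_0 … y_{n-1}` and `y_n … y_{2n-1}`), `h = 2n+1`, `r = 2^{n+1} - 1` — a pair with NO star(`s`) step
for `n > s`, i.e. inside the residual class of the line's open stub `stub_rigidPairs` for every profile `s`.

This part: the vertex embeddings `lo`, `hi`, `apex`; the 0/1 parameter point `sbPoint n` (weight `1` on the diagonal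
anchors `(x_a | y_a)`, `(x_a | y_{n+a})` and on the apex anchors `(x_{2n} | y_a)`, the SINGLE twist
`φ_{(x_{2n} | y_a), x_a} = 1`, everything else `0`); the member of 𝔄₁ at that point is the explicit polynomial
`sbWitness n = ∏_a (1 + x_a y_a) · ∏_a (1 + x_a y_{n+a}) · ∏_a (1 + x_{2n} y_a (1 + x_a))` (`anchoredWitness_sbPoint`);
and the coefficient calculus of its factors: the killing lemma for factors `1 + X_v · g` (`coeff_mul_prod_one_add_X_mul`),
and the diagonal blocks (`coeff_prod_dfac`: `coeff_{x^S y^{e(U)}} ∏_{a∈D}(1 + x_a y_{e a}) = [U ⊆ D][S = x(U)]`); the apex fan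
rule and the theorem are in part 2.

WHAT THIS IS NOT: no non-vanishing statement yet (part 2); nothing on item 19717, on crux stmt-ValiantsHypothesis-14610, or on
`VP` versus `VNP`.
-/

set_option linter.dupNamespace false

namespace Summit.ValiantsHypothesis.ValiantsHypothesis.Theorems.BarrierLever.AnchoredPeeling

open Finset MvPolynomial
open Summit.ValiantsHypothesis.ValiantsHypothesis.Theorems.BarrierLever.BrickCalculus
  (pexpo pexpo_def pexpo_apply_castAdd pexpo_apply_natAdd brick brick_eq coeff_pexpo_mul_brick
   coeff_pexpo_eq_zero_of_vars vars_brick_subset)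
open Summit.ValiantsHypothesis.ValiantsHypothesis.Theorems.BarrierLever.ProductStateSums (castAdd_ne_natAdd)

noncomputable section

namespace SimplexBoundary

variable (n : ℕ)

/-- The low embedding `i ↦ i` of `Fin n` into `Fin (2n+1)` (base `x`-vertices, and the `y`-vertices of block 1). -/
def lo : Fin n ↪ Fin (2 * n + 1) := ⟨fun i => ⟨i, by omega⟩, fun i j hij => Fin.ext (by simpa using Fin.mk.inj_iff.mp hij)⟩

/-- The high embedding `i ↦ n + i` (the `y`-vertices of block 2). -/
def hi : Fin n ↪ Fin (2 * n + 1) :=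
  ⟨fun i => ⟨n + i, by omega⟩, fun i j hij => Fin.ext (by have := Fin.mk.inj_iff.mp hij; omega)⟩

/-- The apex `x`-vertex `2n`. -/
def apex : Fin (2 * n + 1) := ⟨2 * n, by omega⟩

variable {n}

/-- Value of `lo`. -/
@[simp] theorem lo_val (i : Fin n) : ((lo n i : Fin (2 * n + 1)) : ℕ) = i := rfl
/-- Value of `hi`. -/
@[simp] theorem hi_val (i : Fin n) : ((hi n i : Fin (2 * n + 1)) : ℕ) = n + i := rfl
/-- Value of `apex`. -/
@[simp] theorem apex_val : ((apex n : Fin (2 * n + 1)) : ℕ) = 2 * n := rfl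

/-- A base vertex is not the apex. -/
theorem lo_ne_apex (i : Fin n) : lo n i ≠ apex n := by
  intro h; have := congrArg Fin.val h; simp at this; omega

/-- A block-2 index is not the apex index. -/
theorem hi_ne_apex (i : Fin n) : hi n i ≠ apex n := by
  intro h; have := congrArg Fin.val h; simp at this; omega

/-- Low and high indices differ. -/
theorem lo_ne_hi (i j : Fin n) : lo n i ≠ hi n j := by
  intro h; have := congrArg Fin.val h; simp at this; omega

/-- The apex lies in no set of base vertices. -/
theorem apex_not_mem_map_lo (U : Finset (Fin n)) : apex n ∉ U.map (lo n) := by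
  intro h
  obtain ⟨i, -, hi⟩ := Finset.mem_map.mp h
  exact lo_ne_apex i hi

/-- Block-2 indices avoid images of `lo`. -/
theorem hi_not_mem_map_lo (U : Finset (Fin n)) (j : Fin n) : hi n j ∉ U.map (lo n) := by
  intro h
  obtain ⟨i, -, hi'⟩ := Finset.mem_map.mp h
  exact lo_ne_hi i j hi'

/-- Low indices avoid images of `hi`. -/
theorem lo_not_mem_map_hi (U : Finset (Fin n)) (j : Fin n) : lo n j ∉ U.map (hi n) := by
  intro h
  obtain ⟨i, -, hi'⟩ := Finset.mem_map.mp h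
  exact lo_ne_hi j i hi'.symm

/-! ## 1. The 0/1 point and the explicit member -/

/-- Diagonal anchors onto block 1: `(x_a | y_a)`. -/
def diag₁ (n : ℕ) : Finset (Finset (Fin (2 * n + 1)) × Finset (Fin (2 * n + 1))) :=
  Finset.univ.image fun a : Fin n => ({lo n a}, {lo n a})

/-- Diagonal anchors onto block 2: `(x_a | y_{n+a})`. -/
def diag₂ (n : ℕ) : Finset (Finset (Fin (2 * n + 1)) × Finset (Fin (2 * n + 1))) :=
  Finset.univ.image fun a : Fin n => ({lo n a}, {hi n a})

/-- Apex anchors `(x_{2n} | y_a)`. -/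
def apexA (n : ℕ) : Finset (Finset (Fin (2 * n + 1)) × Finset (Fin (2 * n + 1))) :=
  Finset.univ.image fun a : Fin n => ({apex n}, {lo n a})

/-- The 0/1 parameter point: weight `1` on the selected anchors, the single twist `φ_{(apex | y_a), x_a} = 1`, all else `0`. -/
def sbPoint (n : ℕ) : Param (2 * n + 1) → ℂ
  | Sum.inl α => if α ∈ diag₁ n ∪ diag₂ n ∪ apexA n then 1 else 0
  | Sum.inr (Sum.inl (α, b)) => if α.1 = {apex n} ∧ α.2 = {b} ∧ (b : ℕ) < n then 1 else 0
  | Sum.inr (Sum.inr _) => 0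

/-- The diagonal factor `1 + y_{e a} x_a` (variable order chosen for the killing lemma). -/
def dfac (e : Fin n ↪ Fin (2 * n + 1)) (a : Fin n) : MvPolynomial (Fin ((2 * n + 1) + (2 * n + 1))) ℂ :=
  1 + X (Fin.natAdd (2 * n + 1) (e a)) * X (Fin.castAdd (2 * n + 1) (lo n a))

/-- The apex factor `1 + y_a · (x_{2n} (1 + x_a))`. -/
def afac (a : Fin n) : MvPolynomial (Fin ((2 * n + 1) + (2 * n + 1))) ℂ :=
  1 + X (Fin.natAdd (2 * n + 1) (lo n a)) * (X (Fin.castAdd (2 * n + 1) (apex n)) * (1 + X (Fin.castAdd (2 * n + 1) (lo n a))))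

/-- The explicit member `F = ∏_a (1 + x_a y_a) · ∏_a (1 + x_a y_{n+a}) · ∏_a (1 + x_{2n} y_a (1 + x_a))`. -/
def sbWitness (n : ℕ) : MvPolynomial (Fin ((2 * n + 1) + (2 * n + 1))) ℂ :=
  (∏ a : Fin n, dfac (lo n) a) * (∏ a : Fin n, dfac (hi n) a) * ∏ a : Fin n, afac a

/-- A diagonal factor is a weight-one brick. -/
theorem dfac_eq_brick (e : Fin n ↪ Fin (2 * n + 1)) (a : Fin n) : dfac e a = brick {lo n a} {e a} := by
  rw [dfac, brick, C_1, one_mul, Finset.prod_singleton, Finset.prod_singleton, mul_comm (X _)]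

/-- Diagonal anchors have profile one. -/
theorem diag₁_subset : diag₁ n ⊆ anchors 1 (2 * n + 1) := by
  intro α hα; obtain ⟨a, -, rfl⟩ := Finset.mem_image.mp hα; simp [anchors]

/-- Diagonal anchors have profile one. -/
theorem diag₂_subset : diag₂ n ⊆ anchors 1 (2 * n + 1) := by
  intro α hα; obtain ⟨a, -, rfl⟩ := Finset.mem_image.mp hα; simp [anchors]

/-- Apex anchors have profile one. -/
theorem apexA_subset : apexA n ⊆ anchors 1 (2 * n + 1) := by
  intro α hα; obtain ⟨a, -, rfl⟩ := Finset.mem_image.mp hα; simp [anchors]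

/-- The two diagonal anchor families are disjoint. -/
theorem disjoint_diag₁_diag₂ : Disjoint (diag₁ n) (diag₂ n) := by
  rw [Finset.disjoint_left]
  intro α h1 h2
  obtain ⟨a, -, rfl⟩ := Finset.mem_image.mp h1
  obtain ⟨b, -, hb⟩ := Finset.mem_image.mp h2
  have := congrArg Prod.snd hb
  simp only [Finset.singleton_inj] at this
  exact lo_ne_hi a b this.symm

/-- Diagonal and apex anchors are disjoint. -/
theorem disjoint_diag_apexA : Disjoint (diag₁ n ∪ diag₂ n) (apexA n) := by
  rw [Finset.disjoint_left]
  intro α h12 h3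
  obtain ⟨b, -, hb⟩ := Finset.mem_image.mp h3
  have h1 : α.1 = {apex n} := by rw [← hb]
  rcases Finset.mem_union.mp h12 with h | h
  · obtain ⟨a, -, rfl⟩ := Finset.mem_image.mp h
    exact lo_ne_apex a (Finset.singleton_inj.mp h1)
  · obtain ⟨a, -, rfl⟩ := Finset.mem_image.mp h
    exact lo_ne_apex a (Finset.singleton_inj.mp h1)

/-- The twist values at an apex anchor: `φ_{(apex | y_a), b} = [b = x_a]`. -/
theorem sbPoint_twist_apexA (a : Fin n) (b : Fin (2 * n + 1)) :
    sbPoint n (Sum.inr (Sum.inl ((({apex n}, {lo n a}) : Finset (Fin (2 * n + 1)) × Finset (Fin (2 * n + 1))), b))) =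
      if b = lo n a then 1 else 0 := by
  simp only [sbPoint, true_and, Finset.singleton_inj]
  by_cases hb : b = lo n a
  · rw [if_pos hb, if_pos]; exact ⟨hb.symm, by rw [hb]; exact (lo_val a ▸ a.2)⟩
  · rw [if_neg hb, if_neg]; rintro ⟨h1, -⟩; exact hb h1.symm

/-- The apex factor written in terms of the anchor `α = (apex | y_a)`. -/
theorem afac_eq (a : Fin n) : afac a =
    1 + X (Fin.castAdd (2 * n + 1) (apex n)) * (∏ c ∈ ({lo n a} : Finset (Fin (2 * n + 1))), X (Fin.natAdd (2 * n + 1) c)) *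
      (1 + ∏ c ∈ ({lo n a} : Finset (Fin (2 * n + 1))), (X (Fin.castAdd (2 * n + 1) c) :
        MvPolynomial (Fin ((2 * n + 1) + (2 * n + 1))) ℂ)) := by
  rw [afac, Finset.prod_singleton, Finset.prod_singleton]; ring

/-- **The member of 𝔄₁ at `sbPoint n` is the explicit witness.** -/
theorem anchoredWitness_sbPoint (n : ℕ) :
    anchoredWitness 1 (2 * n + 1) (fun α => sbPoint n (Sum.inl α))
      (fun α b => sbPoint n (Sum.inr (Sum.inl (α, b)))) (fun α d => sbPoint n (Sum.inr (Sum.inr (α, d)))) =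
      sbWitness n := by
  classical
  set h := 2 * n + 1 with hh
  -- the value of each anchor factor at the point
  let g : Finset (Fin h) × Finset (Fin h) → MvPolynomial (Fin (h + h)) ℂ := fun α =>
    if α ∈ apexA n then
      1 + X (Fin.castAdd h (apex n)) * (∏ c ∈ α.2, X (Fin.natAdd h c)) * (1 + ∏ c ∈ α.2, X (Fin.castAdd h c))
    else brick α.1 α.2
  have hfac : ∀ α : Finset (Fin h) × Finset (Fin h),
      (1 + C (sbPoint n (Sum.inl α)) * (∏ a ∈ α.1, X (Fin.castAdd h a)) * (∏ c ∈ α.2, X (Fin.natAdd h c)) *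
        (∏ b ∈ univ \ α.1, (1 + C (sbPoint n (Sum.inr (Sum.inl (α, b)))) * X (Fin.castAdd h b))) *
        (∏ d ∈ univ \ α.2, (1 + C (sbPoint n (Sum.inr (Sum.inr (α, d)))) * X (Fin.natAdd h d))) :
          MvPolynomial (Fin (h + h)) ℂ) =
        if α ∈ (diag₁ n ∪ diag₂ n) ∪ apexA n then g α else 1 := by
    intro α
    have hψ : ∀ d, sbPoint n (Sum.inr (Sum.inr (α, d))) = 0 := fun d => rfl
    simp only [hψ, map_zero, zero_mul, add_zero, Finset.prod_const_one, mul_one]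
    by_cases h12 : α ∈ diag₁ n ∪ diag₂ n
    · -- no twist: α.1 is a base vertex, not the apex
      have h3 : α ∉ apexA n := fun h3 => Finset.disjoint_left.mp disjoint_diag_apexA h12 h3
      have hθ : sbPoint n (Sum.inl α) = 1 := by
        simp only [sbPoint]; rw [if_pos (Finset.mem_union_left _ h12)]
      have hφ : ∀ b, sbPoint n (Sum.inr (Sum.inl (α, b))) = 0 := by
        intro b
        simp only [sbPoint]
        rw [if_neg]
        rintro ⟨h1, -, -⟩
        rcases Finset.mem_union.mp h12 with h | h
        · obtain ⟨a, -, rfl⟩ := Finset.mem_image.mp h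
          exact lo_ne_apex a (Finset.singleton_inj.mp h1)
        · obtain ⟨a, -, rfl⟩ := Finset.mem_image.mp h
          exact lo_ne_apex a (Finset.singleton_inj.mp h1)
      simp only [hφ, map_zero, zero_mul, add_zero, Finset.prod_const_one, mul_one, hθ,
        if_pos (Finset.mem_union_left _ h12), g, if_neg h3]
      rw [brick]
    · by_cases h3 : α ∈ apexA n
      · have hθ : sbPoint n (Sum.inl α) = 1 := by
          simp only [sbPoint]; rw [if_pos (Finset.mem_union_right _ h3)]
        rw [if_pos (Finset.mem_union_right _ h3)]
        simp only [g, if_pos h3]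
        obtain ⟨a, -, rfl⟩ := Finset.mem_image.mp h3
        rw [hθ, map_one, one_mul, Finset.prod_singleton]
        simp only [sbPoint_twist_apexA]
        have hprod : (∏ b ∈ univ \ ({apex n} : Finset (Fin h)),
            (1 + C (if b = lo n a then (1 : ℂ) else 0) * X (Fin.castAdd h b)) : MvPolynomial (Fin (h + h)) ℂ) =
            1 + X (Fin.castAdd h (lo n a)) := by
          rw [Finset.prod_congr rfl (fun b _ => show (1 + C (if b = lo n a then (1 : ℂ) else 0) * X (Fin.castAdd h b) :
              MvPolynomial (Fin (h + h)) ℂ) = if b = lo n a then 1 + X (Fin.castAdd h b) else 1 by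
              split_ifs <;> simp)]
          rw [Finset.prod_ite_eq']
          rw [if_pos (Finset.mem_sdiff.mpr ⟨Finset.mem_univ _, fun hmem => lo_ne_apex a (Finset.mem_singleton.mp hmem)⟩)]
        rw [hprod, Finset.prod_singleton, Finset.prod_singleton]
      · have hθ : sbPoint n (Sum.inl α) = 0 := by
          simp only [sbPoint]; rw [if_neg]; intro hmem
          rcases Finset.mem_union.mp hmem with h' | h'
          · exact h12 h'
          · exact h3 h'
        rw [if_neg (fun hmem => (Finset.mem_union.mp hmem).elim h12 h3), hθ, map_zero, zero_mul, zero_mul, zero_mul,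
          add_zero]
  rw [anchoredWitness, Finset.prod_congr rfl (fun α _ => hfac α), ← Finset.prod_filter, Finset.filter_mem_eq_inter,
    Finset.inter_eq_right.mpr (Finset.union_subset (Finset.union_subset diag₁_subset diag₂_subset) apexA_subset),
    Finset.prod_union disjoint_diag_apexA, Finset.prod_union disjoint_diag₁_diag₂]
  -- the three blocks
  have hg12 : ∀ α ∈ diag₁ n ∪ diag₂ n, g α = brick α.1 α.2 := fun α hα => by
    simp only [g, if_neg (fun h3 => Finset.disjoint_left.mp disjoint_diag_apexA hα h3)]
  have hD1 : ∏ α ∈ diag₁ n, g α = ∏ a : Fin n, dfac (lo n) a := by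
    rw [Finset.prod_congr rfl (fun α hα => hg12 α (Finset.mem_union_left _ hα)), diag₁, Finset.prod_image]
    · exact Finset.prod_congr rfl (fun a _ => (dfac_eq_brick (lo n) a).symm)
    · intro a _ b _ hab; exact (lo n).injective (Finset.singleton_injective (congrArg Prod.fst hab))
  have hD2 : ∏ α ∈ diag₂ n, g α = ∏ a : Fin n, dfac (hi n) a := by
    rw [Finset.prod_congr rfl (fun α hα => hg12 α (Finset.mem_union_right _ hα)), diag₂, Finset.prod_image]
    · exact Finset.prod_congr rfl (fun a _ => (dfac_eq_brick (hi n) a).symm)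
    · intro a _ b _ hab; exact (lo n).injective (Finset.singleton_injective (congrArg Prod.fst hab))
  have hA : ∏ α ∈ apexA n, g α = ∏ a : Fin n, afac a := by
    rw [apexA, Finset.prod_image]
    · refine Finset.prod_congr rfl (fun a _ => ?_)
      have hmem : (({apex n}, {lo n a}) : Finset (Fin h) × Finset (Fin h)) ∈ apexA n :=
        Finset.mem_image_of_mem _ (Finset.mem_univ a)
      simp only [g, if_pos hmem]
      rw [afac_eq]
    · intro a _ b _ hab; exact (lo n).injective (Finset.singleton_injective (congrArg Prod.snd hab))
  rw [hD1, hD2, hA, sbWitness]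

/-! ## 2. Coefficient calculus for the explicit member -/

section Coeff

variable {σ : Type*} [DecidableEq σ]

/-- Killing lemma: a factor `1 + X v · g` does not change the coefficients of monomials avoiding `v`. -/
theorem coeff_mul_one_add_X_mul (m : σ →₀ ℕ) (v : σ) (f g : MvPolynomial σ ℂ) (hv : m v = 0) :
    coeff m (f * (1 + X v * g)) = coeff m f := by
  rw [mul_add, mul_one, coeff_add, show f * (X v * g) = (f * g) * X v by ring, coeff_mul_X', if_neg, add_zero]
  rwa [Finsupp.mem_support_iff, not_not]

/-- Killing lemma for a product of such factors. -/
theorem coeff_mul_prod_one_add_X_mul {ι : Type*} (t : Finset ι) (v : ι → σ) (g : ι → MvPolynomial σ ℂ)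
    (m : σ →₀ ℕ) (f : MvPolynomial σ ℂ) (hv : ∀ i ∈ t, m (v i) = 0) :
    coeff m (f * ∏ i ∈ t, (1 + X (v i) * g i)) = coeff m f := by
  classical
  induction t using Finset.induction_on generalizing f with
  | empty => rw [Finset.prod_empty, mul_one]
  | insert i t hi ih =>
    rw [Finset.prod_insert hi, ← mul_assoc, mul_right_comm, coeff_mul_one_add_X_mul _ _ _ _
      (hv i (Finset.mem_insert_self i t)), ih f (fun i' hi' => hv i' (Finset.mem_insert_of_mem hi'))]

end Coeff

/-- `pexpo S T = 0` iff both sets are empty. -/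
theorem pexpo_eq_zero_iff (S T : Finset (Fin (2 * n + 1))) : pexpo S T = 0 ↔ S = ∅ ∧ T = ∅ := by
  constructor
  · intro h0
    refine ⟨Finset.eq_empty_of_forall_notMem (fun a ha => ?_), Finset.eq_empty_of_forall_notMem (fun c hc => ?_)⟩
    · have := congrArg (fun m => m (Fin.castAdd (2 * n + 1) a)) h0
      simp only [pexpo_apply_castAdd, if_pos ha, Finsupp.coe_zero, Pi.zero_apply] at this
      exact one_ne_zero this
    · have := congrArg (fun m => m (Fin.natAdd (2 * n + 1) c)) h0
      simp only [pexpo_apply_natAdd, if_pos hc, Finsupp.coe_zero, Pi.zero_apply] at this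
      exact one_ne_zero this
  · rintro ⟨rfl, rfl⟩
    rw [pexpo_def, Finset.sum_empty, Finset.sum_empty, add_zero]

/-- Variables of a block of diagonal factors. -/
theorem vars_prod_dfac_subset (e : Fin n ↪ Fin (2 * n + 1)) (D : Finset (Fin n)) :
    (∏ a ∈ D, dfac e a).vars ⊆ (D.map (lo n)).image (Fin.castAdd (2 * n + 1)) ∪ (D.map e).image (Fin.natAdd (2 * n + 1)) := by
  classical
  induction D using Finset.induction_on with
  | empty => rw [Finset.prod_empty, vars_one]; exact Finset.empty_subset _
  | insert a D ha ih =>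
    rw [Finset.prod_insert ha, mul_comm (dfac e a), dfac_eq_brick]
    refine BrickCalculus.vars_mul_brick_subset _ _ _ _ _ (ih.trans ?_) ?_ ?_
    · exact Finset.union_subset_union
        (Finset.image_subset_image (Finset.map_subset_map.mpr (Finset.subset_insert a D)))
        (Finset.image_subset_image (Finset.map_subset_map.mpr (Finset.subset_insert a D)))
    · exact Finset.singleton_subset_iff.mpr (Finset.mem_map_of_mem _ (Finset.mem_insert_self a D))
    · exact Finset.singleton_subset_iff.mpr (Finset.mem_map_of_mem _ (Finset.mem_insert_self a D))

/-- **Coefficients of a diagonal block**: `coeff_{x^S y^{e(U)}} ∏_{a∈D} (1 + x_a y_{e a}) = [U ⊆ D][S = x(U)]`. -/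
theorem coeff_prod_dfac (e : Fin n ↪ Fin (2 * n + 1)) (D : Finset (Fin n)) (S : Finset (Fin (2 * n + 1)))
    (U : Finset (Fin n)) :
    coeff (pexpo S (U.map e)) (∏ a ∈ D, dfac e a) = if U ⊆ D ∧ S = U.map (lo n) then 1 else 0 := by
  classical
  induction D using Finset.induction_on generalizing S U with
  | empty =>
    rw [Finset.prod_empty, ← C_1, coeff_C]
    by_cases h0 : S = ∅ ∧ U = ∅
    · obtain ⟨rfl, rfl⟩ := h0
      rw [if_pos ((pexpo_eq_zero_iff _ _).mpr ⟨rfl, Finset.map_empty _⟩).symm, if_pos ⟨subset_rfl, (Finset.map_empty _).symm⟩]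
    · rw [if_neg, if_neg]
      · rintro ⟨hU, hS⟩
        have hU' : U = ∅ := Finset.subset_empty.mp hU
        rw [hU', Finset.map_empty] at hS
        exact h0 ⟨hS, hU'⟩
      · intro hz
        have := (pexpo_eq_zero_iff _ _).mp hz.symm
        exact h0 ⟨this.1, Finset.map_eq_empty.mp this.2⟩
  | insert a D ha ih =>
    rw [Finset.prod_insert ha, mul_comm (dfac e a), dfac_eq_brick, coeff_pexpo_mul_brick, ih]
    have hea : ({e a} : Finset (Fin (2 * n + 1))) ⊆ U.map e ↔ a ∈ U := by
      rw [Finset.singleton_subset_iff, Finset.mem_map' e]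
    by_cases haU : a ∈ U
    · -- `a ∈ U`: only the second term can contribute
      have h1 : ¬ (U ⊆ D ∧ S = U.map (lo n)) := fun hc => ha (hc.1 haU)
      rw [if_neg h1, zero_add]
      by_cases hlo : lo n a ∈ S
      · rw [if_pos ⟨Finset.singleton_subset_iff.mpr hlo, hea.mpr haU⟩, Finset.sdiff_singleton_eq_erase,
          Finset.sdiff_singleton_eq_erase, ← Finset.map_erase, ih]
        have key : (U.erase a ⊆ D ∧ S.erase (lo n a) = (U.erase a).map (lo n)) ↔ (U ⊆ insert a D ∧ S = U.map (lo n)) := by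
          rw [Finset.map_erase, ← Finset.subset_insert_iff]
          refine and_congr_right (fun _ => ⟨fun hS => ?_, fun hS => by rw [hS]⟩)
          rw [← Finset.insert_erase hlo, hS, Finset.insert_erase (Finset.mem_map_of_mem _ haU)]
        rw [if_congr key rfl rfl]
      · rw [if_neg (fun hc => hlo (Finset.singleton_subset_iff.mp hc.1)), if_neg]
        rintro ⟨-, hS⟩
        exact hlo (hS ▸ Finset.mem_map_of_mem _ haU)
    · -- `a ∉ U`: only the first term can contribute
      rw [if_neg (show ¬ (({lo n a} : Finset (Fin (2 * n + 1))) ⊆ S ∧ {e a} ⊆ U.map e) from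
        fun hc => haU (hea.mp hc.2)), add_zero]
      have key : (U ⊆ D ∧ S = U.map (lo n)) ↔ (U ⊆ insert a D ∧ S = U.map (lo n)) := by
        refine and_congr_left (fun _ => ⟨fun hU => hU.trans (Finset.subset_insert a D), fun hU x hx => ?_⟩)
        rcases Finset.mem_insert.mp (hU hx) with rfl | hxD
        · exact absurd hx haU
        · exact hxD
      rw [if_congr key rfl rfl]

end SimplexBoundary

end

end Summit.ValiantsHypothesis.ValiantsHypothesis.Theorems.BarrierLever.AnchoredPeeling
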